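import Mathlib.Topology.MetricSpace.Contracting
import Mathlib.Analysis.Normed.Module.Basic
import HarnessLib

/-!
# Route `UnitScaleTilt`, crux K1 «MinimiserStabilityRegPr» (stmt-QuantumFields-19200), route-R E′ path (α′), row (E1-d) of LOCATE-E1-CONTRACTION: THE EXACT CORRECTOR'S CONTRACTION,
# ABSTRACTLY — for a bounded linear `L : Y → X` (the linear corrector, bound `C_L` = (hK₀)(hK)(hK₂)) and a quadratic-type `N : X → Y` (`N 0 = 0`, Lipschitz modulus
# `C_N(‖ψ‖+‖ψ′‖+s)` on a ball = the chart remainder with its divergence row) and data `D` with `‖D‖ ≤ s`: under the window `C_L·C_N·(7C_L s + s) ≤ 1∕2` there is a UNIQUE `ψ` with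
# `‖ψ‖ ≤ 3C_L s` and `ψ = L D + L (N ψ)` — i.e. `R(ψ) = 0` in the (α′) reading (LOCATE §1), by Banach's fixed point on the closed ball

Cell `ym3-torus`, D-0154 (3c) twin-width seat `ym-routeR-w3` (gen 5); ★p1 g15 20:35:45Z «routeR-w3: (E1) LOCATE — GO» → LOCATE `ym-routeR-w3/LOCATE-E1-CONTRACTION-routeRw3g5.md` §4∕§5 (E1-d).
THEOREMS ONLY (0 `def`, 0 `sorry`); `--supports stmt-QuantumFields-19200`, count-neutral.  YM₃ on T³ is a ladder rung (R3), not the Clay problem; nothing here claims the stub, the crux,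
d = 4 or the gap.  Pure functional analysis (Mathlib `ContractingWith.exists_fixedPoint'` on the closed ball); the instantiation (X = pinned Herm-tr0 site fields with the three sup rows,
Y = bond fields with sup + divergence rows, `L = LinCorr`, `N` = chart remainder) is the knit's (E1-e).

WHAT IS PROVED (ns `…Theorems.Prop7ExactCorrectorContraction`; `X` complete real normed space, `Y` real normed space).
* `norm_le_of_mem_closedBall_zero`, `maps_closedBall` (Φ maps the ball `‖ψ‖ ≤ ρ`, `ρ = 3C_L s`, into itself), `lipschitz_on_closedBall` (Φ is a `½`-contraction there).
* ★★★ `exists_unique_exact_corrector` — `∃ ψ, ‖ψ‖ ≤ 3C_L s ∧ ψ = L D + L (N ψ) ∧ ∀ ψ′, ‖ψ′‖ ≤ 3C_L s → ψ′ = L D + L (N ψ′) → ψ′ = ψ`.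
HONEST SCOPE.  Abstract; no lattice object appears.

References: T. Bałaban, CMP 102 (1985) 277–309 [Balaban1985Variational] (Prop. 7 p.299); CMP 99 (1985) 75–102 [Balaban1985RegularSpaces] ((1.36) p.82).
-/

set_option autoImplicit false

noncomputable section

open Metric Set

namespace Summit.QuantumFields.YangMills.Theorems.Prop7ExactCorrectorContraction

variable {X Y : Type*} [NormedAddCommGroup X] [NormedSpace ℝ X] [CompleteSpace X] [NormedAddCommGroup Y] [NormedSpace ℝ Y]

/-- ★★★ **THE EXACT CORRECTOR BY CONTRACTION.**  `L : Y →ₗ[ℝ] X` with `‖L y‖ ≤ C_L‖y‖`; `N : X → Y` with `N 0 = 0` and `‖N ψ − N ψ′‖ ≤ C_N(‖ψ‖ + ‖ψ′‖ + s)‖ψ − ψ′‖` whenever `‖ψ‖, ‖ψ′‖ ≤ 3C_L s`;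
data `‖D‖ ≤ s`, `0 ≤ s`, `0 ≤ C_L`, `0 ≤ C_N`; window `C_L·C_N·(7C_L s + s) ≤ 1∕2`.  Then there is exactly one `ψ` in the ball `‖ψ‖ ≤ 3C_L s` with `ψ = L D + L (N ψ)`.
[cite: Balaban1985Variational, Prop. 7 p.299] -/
theorem exists_unique_exact_corrector (L : Y →ₗ[ℝ] X) (N : X → Y) (D : Y) {C_L C_N s : ℝ} (hCL : 0 ≤ C_L) (hCN : 0 ≤ C_N) (hs : 0 ≤ s)
    (hL : ∀ y, ‖L y‖ ≤ C_L * ‖y‖) (hN0 : N 0 = 0)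
    (hN : ∀ ψ ψ', ‖ψ‖ ≤ 3 * C_L * s → ‖ψ'‖ ≤ 3 * C_L * s → ‖N ψ - N ψ'‖ ≤ C_N * (‖ψ‖ + ‖ψ'‖ + s) * ‖ψ - ψ'‖)
    (hD : ‖D‖ ≤ s) (hwin : C_L * C_N * (7 * C_L * s + s) ≤ 1 / 2) :
    ∃ ψ : X, ‖ψ‖ ≤ 3 * C_L * s ∧ ψ = L D + L (N ψ) ∧ ∀ ψ' : X, ‖ψ'‖ ≤ 3 * C_L * s → ψ' = L D + L (N ψ') → ψ' = ψ := by
  set ρ : ℝ := 3 * C_L * s with hρ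
  have hρ0 : 0 ≤ ρ := by positivity
  set Φ : X → X := fun ψ => L D + L (N ψ) with hΦ
  -- size of `N ψ` on the ball (from `N 0 = 0`)
  have hNψ : ∀ ψ, ‖ψ‖ ≤ ρ → ‖N ψ‖ ≤ C_N * (ρ + s) * ρ := by
    intro ψ hψ
    have h := hN ψ 0 hψ (by simp [hρ0])
    rw [hN0, sub_zero, norm_zero, add_zero, sub_zero] at h
    calc ‖N ψ‖ ≤ C_N * (‖ψ‖ + s) * ‖ψ‖ := h
      _ ≤ C_N * (ρ + s) * ρ := by gcongr
  -- Φ maps the closed ball into itself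
  have hmaps : MapsTo Φ (closedBall (0 : X) ρ) (closedBall (0 : X) ρ) := by
    intro ψ hψ
    rw [mem_closedBall, dist_zero_right] at hψ ⊢
    have h1 : ‖Φ ψ‖ ≤ C_L * s + C_L * (C_N * (ρ + s) * ρ) := by
      calc ‖Φ ψ‖ ≤ ‖L D‖ + ‖L (N ψ)‖ := norm_add_le _ _
        _ ≤ C_L * ‖D‖ + C_L * ‖N ψ‖ := add_le_add (hL D) (hL (N ψ))
        _ ≤ C_L * s + C_L * (C_N * (ρ + s) * ρ) := by gcongr; exact hNψ ψ hψ
    -- `C_L·C_N(ρ+s) ≤ 1/2 ≤ 2/3` turns this into `≤ ρ`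
    have hq : C_L * C_N * (ρ + s) ≤ 1 / 2 := by
      have : ρ + s ≤ 7 * C_L * s + s := by rw [hρ]; nlinarith
      calc C_L * C_N * (ρ + s) ≤ C_L * C_N * (7 * C_L * s + s) := by gcongr
        _ ≤ 1 / 2 := hwin
    calc ‖Φ ψ‖ ≤ C_L * s + C_L * (C_N * (ρ + s) * ρ) := h1
      _ = C_L * s + (C_L * C_N * (ρ + s)) * ρ := by ring
      _ ≤ C_L * s + (1 / 2) * ρ := by gcongr
      _ ≤ ρ := by rw [hρ]; nlinarith
  -- Φ is a `1/2`-contraction on the ball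
  have hlip : ∀ ψ ψ', ‖ψ‖ ≤ ρ → ‖ψ'‖ ≤ ρ → ‖Φ ψ - Φ ψ'‖ ≤ (1 / 2) * ‖ψ - ψ'‖ := by
    intro ψ ψ' hψ hψ'
    have e : Φ ψ - Φ ψ' = L (N ψ - N ψ') := by simp only [hΦ, map_sub]; abel
    rw [e]
    calc ‖L (N ψ - N ψ')‖ ≤ C_L * ‖N ψ - N ψ'‖ := hL _
      _ ≤ C_L * (C_N * (‖ψ‖ + ‖ψ'‖ + s) * ‖ψ - ψ'‖) := by gcongr; exact hN ψ ψ' hψ hψ'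
      _ = (C_L * C_N * (‖ψ‖ + ‖ψ'‖ + s)) * ‖ψ - ψ'‖ := by ring
      _ ≤ (C_L * C_N * (7 * C_L * s + s)) * ‖ψ - ψ'‖ := by
          gcongr
          rw [hρ] at hψ hψ'
          linarith
      _ ≤ (1 / 2) * ‖ψ - ψ'‖ := by gcongr
  -- Banach on the complete subset `closedBall 0 ρ`
  have hK : ContractingWith (1 / 2 : NNReal) (hmaps.restrict Φ (closedBall (0 : X) ρ) (closedBall (0 : X) ρ)) := by
    refine ⟨by norm_num, LipschitzWith.of_dist_le_mul fun a b => ?_⟩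
    have ha := a.2; have hb := b.2
    rw [mem_closedBall, dist_zero_right] at ha hb
    simp only [Subtype.dist_eq, MapsTo.val_restrict_apply, dist_eq_norm, NNReal.coe_div, NNReal.coe_one, NNReal.coe_ofNat]
    exact hlip a.1 b.1 ha hb
  have h0mem : (0 : X) ∈ closedBall (0 : X) ρ := by simp [hρ0]
  obtain ⟨ψ, hψmem, hfix, -⟩ := hK.exists_fixedPoint' (isClosed_closedBall.isComplete) hmaps h0mem (edist_ne_top _ _)
  rw [mem_closedBall, dist_zero_right] at hψmem
  refine ⟨ψ, hψmem, hfix.symm, ?_⟩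
  intro ψ' hψ' hfix'
  -- uniqueness in the ball from the contraction
  have h := hlip ψ' ψ hψ' hψmem
  have e1 : Φ ψ' = ψ' := by
    show L D + L (N ψ') = ψ'
    exact hfix'.symm
  have e2 : Φ ψ = ψ := hfix
  rw [e1, e2] at h
  have hn : ‖ψ' - ψ‖ = 0 := by nlinarith [norm_nonneg (ψ' - ψ)]
  exact sub_eq_zero.mp (norm_eq_zero.mp hn)

end Summit.QuantumFields.YangMills.Theorems.Prop7ExactCorrectorContraction
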